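import Summits.QuantumFields.YangMills.Theorems.BalabanUVNodesN15NeumannCubeLiftRows
import Summits.QuantumFields.YangMills.Theorems.BalabanUVNodesN15NeumannCubeGradientDefect
import HarnessLib

/-!
# Route «BalabanUVNodes» (K3⁷), node N15 = NE2, -a lane, PROGRAMME P file P-IIc: THE TWO-GRID η-DEFECT OF THE LIFTED NEUMANN CUBE PROPAGATORS ON THE TORUS FAMILY OF RECORD (`hDGc`) —
# King's pairing commutes with the periodisation; the defect of two transplants is the two-lattice transplant of the small defect; cube side `L^s` FIXED, volume FREE

Cell `pub-ymgap`, seat `pub-ymgap-dag-n15-a` (KNIT-BY-NAME, g20; D-0062; chair R424 venue; `bears_on: R4∕N15`); `--kind proof --supports stmt-QuantumFields-20544 --as helper`.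
Sequel of P-IIa∕P-IIb (`…N15NeumannCubeLift`, `…N15NeumannCubeLiftRows`: `liftCubeG`, `cubeW`, `redBond`, `kingBlockOf_torRed`, `mulOp_chiCube_comp_liftCubeG`, `MP_dvd_MP`) over programme N's
two-grid rows on the doubled tori (N-IIc `hasMaj_idef_chiCube_neumannCubeG`, N-IIe `hasMaj_idef_chiCube_grad_neumannCubeG`).  CONSUMER: dag-n15-c's
`hasMaj_idef_glued_of_cutRows` (rows `hDGc`, entry-1 `hDK` pieces) on the torus of record.

WHAT.  §11 two spacings `L^k`, `L^r·L^k` under `π`: ★ `kingPr_torRed`∕`kingPrV_redBond` (KING's PAIRING COMMUTES WITH THE PERIODISATION), `kingPrV_mem_cubeW_iff`, `exists_redBond_eq`,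
★ `kingPrV_not_mem_image` (COMPLEMENT CONDITION replacing the chart surjectivity the lit's `restrictOp_comp_pull` needs: the image cube is one of `2^{d+1}` cells).  §12 two-lattice algebra:
★ `restrictOp_comp_pull_of_compl`, ★★ `idef_transplant_eq_extend_comp_restrict` (`𝔇(ε₂X₂′ρ₂, ε₁X₁′ρ₁) = ε₂ ∘ 𝔇′(X₂′, X₁′) ∘ ρ₁`), ★★ `hasMaj_extend_comp_restrict_of_blockMap` (TWO-LATTICE TRANSFER LEMMA),
`extendOp_comp_mulOp_of_eq_one`, `idef_mulOp_mulOp_of_comp`.  §13 on `MP (paramsOf d L m_T k hL)` with cube torus `MP (paramsOf d L s k hL)`, `s ≤ m_T`: ★★ `hasMaj_idef_transplant_cube_family`,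
★★★ `hasMaj_idef_chiCube_liftCubeG` (`hDGc`: N-IIc's `δ, m`, rate `(L^k)^{−γ∕2}`), `mulOp_chiCube_comp_sD_comp_liftCubeG`, ★★★ `hasMaj_idef_chiCube_grad_liftCubeG` (entry-1 defect: N-IIe's letter,
rate `(L^k)^{−1∕16}`) — for EVERY `s ≤ m_T`, `k`, `r`, corner `c`: UNIFORM in the volume.
HONEST FRAMING.  Count-neutral; finite lattice algebra + block-majorant bookkeeping over LANDED rows (no new analytic estimate: King's two-grid rate = part 52 `hasMaj_twoGridDefect` through programme N);
`U ≡ 1` torus MODEL of [B5] §1; the entry-2 two-grid rows (N-IIg∕h, input-side `∇*`) lift by the same two lemmas once the sandwiched form is transported (on the consumer's word); nothing of [B6] (2.38)–(2.40)∕[B9] asserted; NE2⁺ NOT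
PRINTED; N15 NOT discharged (object-bound); counts UNMOVED (typed 28∕28 · discharged 5∕27); finite tori at fixed lattice spacing — NOT continuum ∕ ℝ⁴ ∕ OS ∕ mass gap ∕ Clay.  No new definition;
every theorem is [folklore] lattice algebra ∕ bookkeeping about printed objects.
-/

noncomputable section

open scoped BigOperators Matrix
open Finset

namespace Summit.QuantumFields.YangMills.BalabanUVNodes.N15.TwoGrid

open Literature.MathematicalPhysics.QuantumFieldTheory.Balaban1983to89
open Literature.MathematicalPhysics.QuantumFieldTheory.Balaban1983to89.B5Prop11Plancherel (Tor fine unitVec)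
open Literature.MathematicalPhysics.QuantumFieldTheory.Balaban1983to89.B5Block118 (tstep up upHom iota bpt)
open Literature.MathematicalPhysics.QuantumFieldTheory.Balaban1983to89.B5SiteBridgeP12 (MP)

variable {d : ℕ}

/-! ## §11 Two lattice spacings under the periodisation: King's pairing commutes with `π`; windows, images and complements -/

section TwoSpacings

open Literature.MathematicalPhysics.QuantumFieldTheory.Balaban1983to89.B6Prop26Gluing (mulOp mulOp_apply ind ind_nonneg ind_le_one)
open Literature.MathematicalPhysics.QuantumFieldTheory.Balaban1983to89.B6Prop26ReachTransplant (restrictOp extendOp transplant restrictOp_apply restrictOp_apply_of_injOn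
  restrictOp_apply_of_not_mem extendOp_apply transplant_apply)
open Literature.MathematicalPhysics.QuantumFieldTheory.King1986.Torus (blockOf tdistT)
open Literature.MathematicalPhysics.QuantumFieldTheory.Balaban1983to89.T4EtaRateDefect (idef)
open Literature.MathematicalPhysics.QuantumFieldTheory.Balaban1983to89.T4EtaRateCoeffDefect (pull pull_apply)
open Summit.QuantumFields.YangMills.BalabanUVNodes.N15.VectorPiece (kingPr kingPrV kingPr_val kingPrV_eq blkFine blkFine_comp_kingPrV)

variable {L k r : ℕ} [NeZero L] {M M' : Fin (d + 1) → ℕ} [∀ μ, NeZero (M μ)] [∀ μ, NeZero (M' μ)] (hM : ∀ μ, M' μ ∣ M μ) {c : Tor M} {S : ℕ}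

/-- the value of a reduced coordinate is the residue of the value. [folklore] -/
theorem val_torRed_eq_mod {N N' : Fin (d + 1) → ℕ} [∀ μ, NeZero (N μ)] [∀ μ, NeZero (N' μ)] (hN : ∀ μ, N' μ ∣ N μ) (z : Tor N) (ν : Fin (d + 1)) :
    (torRed hN z ν).val = (z ν).val % N' ν := by
  rw [torRed_apply, ZMod.castHom_apply, ZMod.cast_eq_val, ZMod.val_natCast]

/-- ★ **KING's PAIRING COMMUTES WITH THE PERIODISATION**: `pr(πx′) = π(pr x′)` (`⌊(x′ mod L^rL^kM′)∕L^r⌋ = ⌊x′∕L^r⌋ mod L^kM′`). [cite: King1986, p.664 (convention before Prop. 3.8)] -/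
theorem kingPr_torRed (x' : Tor (fine (L ^ r * L ^ k) M)) :
    kingPr L k r M' (torRed (fine_dvd (L ^ r * L ^ k) hM) x') = torRed (fine_dvd (L ^ k) hM) (kingPr L k r M x') := by
  funext ν
  apply ZMod.val_injective
  rw [kingPr_val, val_torRed_eq_mod, val_torRed_eq_mod, kingPr_val]
  show (x' ν).val % (L ^ r * L ^ k * M' ν) / L ^ r = (x' ν).val / L ^ r % (L ^ k * M' ν)
  rw [mul_assoc, Nat.mod_mul_right_div_self]

/-- the same for bonds. [folklore] -/
theorem kingPrV_redBond (b : Tor (fine (L ^ r * L ^ k) M) × Fin (d + 1)) : kingPrV L k r M' (redBond (L ^ r * L ^ k) hM b) = redBond (L ^ k) hM (kingPrV L k r M b) := by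
  rw [kingPrV_eq, kingPrV_eq]; exact Prod.ext (kingPr_torRed hM b.1) rfl

omit [∀ μ, NeZero (M' μ)] in
/-- the coarse image of a fine cube bond is a coarse cube bond, and conversely (blocks are preserved by the pairing). [folklore] -/
theorem kingPrV_mem_cubeW_iff (b : Tor (fine (L ^ r * L ^ k) M) × Fin (d + 1)) : kingPrV L k r M b ∈ cubeW (L ^ k) c S ↔ b ∈ cubeW (L ^ r * L ^ k) c S := by
  rw [mem_cubeW, mem_cubeW]
  have h : blockOf (L ^ k) M (kingPrV L k r M b).1 = blockOf (L ^ r * L ^ k) M b.1 := congrFun (blkFine_comp_kingPrV M L k r) b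
  rw [h]

/-- every bond of the small torus whose block is the image of a cube block IS the image of a cube bond (any spacing `n`). [folklore] -/
theorem exists_redBond_eq {n : ℕ} [NeZero n] {x' : Tor (fine n M') × Fin (d + 1)} {y : Tor M} (hy : y ∈ cubeBlocks M c S) (h : blockOf n M' x'.1 = torRed hM y) :
    ∃ x ∈ cubeW n c S, redBond n hM x = x' := by
  obtain ⟨a, ha⟩ := exists_eq_bpt_blockOf M' n x'.1
  refine ⟨(bpt n M y a, x'.2), (mem_cubeW _).mpr (by rw [DefectKernel.kingBlockOf_bpt]; exact hy), ?_⟩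
  refine Prod.ext ?_ rfl
  show torRed (fine_dvd n hM) (bpt n M y a) = x'.1
  rw [torRed_bpt n hM, ← h, ← ha]

/-- ★ THE COMPLEMENT CONDITION: a fine bond of the small torus outside the image of the fine window pairs to a coarse bond outside the image of the coarse window. [folklore] -/
theorem kingPrV_not_mem_image (x₂' : Tor (fine (L ^ r * L ^ k) M') × Fin (d + 1)) (hx : ∀ x₂ ∈ cubeW (L ^ r * L ^ k) c S, redBond (L ^ r * L ^ k) hM x₂ ≠ x₂') :
    ∀ x₁ ∈ cubeW (L ^ k) c S, redBond (L ^ k) hM x₁ ≠ kingPrV L k r M' x₂' := by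
  intro x₁ hx₁ heq
  rw [mem_cubeW] at hx₁
  -- the fine block of `x₂′` is the image of the cube block of `x₁`
  have h1 : blockOf (L ^ k) M' (kingPrV L k r M' x₂').1 = blockOf (L ^ r * L ^ k) M' x₂'.1 := congrFun (blkFine_comp_kingPrV M' L k r) x₂'
  have h2 : blockOf (L ^ r * L ^ k) M' x₂'.1 = torRed hM (blockOf (L ^ k) M x₁.1) := by
    rw [← h1, ← heq]; exact kingBlockOf_torRed x₁.1
  obtain ⟨x₂, hx₂W, hx₂e⟩ := exists_redBond_eq hM hx₁ h2
  exact hx x₂ hx₂W hx₂e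

end TwoSpacings

/-! ## §12 The η-defect of a pair of transplants is the two-lattice transplant of the small-torus defect; the two-lattice transfer lemma -/

section TwoLattice

open Literature.MathematicalPhysics.QuantumFieldTheory.Balaban1983to89.B6Prop26Gluing (mulOp mulOp_apply ind ind_nonneg ind_le_one)
open Literature.MathematicalPhysics.QuantumFieldTheory.Balaban1983to89.B6Prop26ReachTransplant (restrictOp extendOp transplant restrictOp_apply restrictOp_apply_of_injOn
  restrictOp_apply_of_not_mem extendOp_apply transplant_apply)
open Literature.MathematicalPhysics.QuantumFieldTheory.Balaban1983to89.T4EtaRateDefect (idef)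
open Literature.MathematicalPhysics.QuantumFieldTheory.Balaban1983to89.T4EtaRateCoeffDefect (pull pull_apply)
open Literature.MathematicalPhysics.QuantumFieldTheory.Balaban1983to89.B11SectG (BlockNorm HasMaj)
open Literature.MathematicalPhysics.QuantumFieldTheory.Balaban1983to89.B11AxialTransport190 (abs_le_loc_ofBlocks loc_ofBlocks_le)

variable {X₁ X₂ X₁' X₂' : Type} [Fintype X₁] [Fintype X₂] [Fintype X₁'] [Fintype X₂'] [DecidableEq X₁] [DecidableEq X₂] [DecidableEq X₁'] [DecidableEq X₂']
  (W₁ : Finset X₁) (e₁ : X₁ → X₁') (W₂ : Finset X₂) (e₂ : X₂ → X₂') (p : X₂ → X₁) (p' : X₂' → X₁')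

omit [Fintype X₁] [Fintype X₂] [Fintype X₁'] [Fintype X₂'] [DecidableEq X₁] [DecidableEq X₂] in
/-- RESTRICTION THROUGH PULL-BACK WITHOUT SURJECTIVITY OF THE CHARTS: compatible windows (`x₂ ∈ W₂ ↔ p x₂ ∈ W₁`), compatible charts (`e₁(p x₂) = p′(e₂ x₂)` on `W₂`), injective charts,
and the COMPLEMENT condition (a point off the image of `W₂` pairs to a point off the image of `W₁`) give `ρ₂ ∘ pull p = pull p′ ∘ ρ₁`. [folklore] -/
theorem restrictOp_comp_pull_of_compl (hinj₁ : Set.InjOn e₁ ↑W₁) (hinj₂ : Set.InjOn e₂ ↑W₂) (hW : ∀ x₂, x₂ ∈ W₂ ↔ p x₂ ∈ W₁) (hcompat : ∀ x₂ ∈ W₂, e₁ (p x₂) = p' (e₂ x₂))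
    (hcompl : ∀ x₂' : X₂', (∀ x₂ ∈ W₂, e₂ x₂ ≠ x₂') → ∀ x₁ ∈ W₁, e₁ x₁ ≠ p' x₂') :
    restrictOp W₂ e₂ ∘ₗ pull p = pull p' ∘ₗ restrictOp W₁ e₁ := by
  refine LinearMap.ext fun f => funext fun x₂' => ?_
  rw [LinearMap.comp_apply, LinearMap.comp_apply, pull_apply]
  by_cases hx : ∃ x₂ ∈ W₂, e₂ x₂ = x₂'
  · obtain ⟨x₂, hx₂, rfl⟩ := hx
    rw [restrictOp_apply_of_injOn hinj₂ _ hx₂, pull_apply, ← hcompat x₂ hx₂, restrictOp_apply_of_injOn hinj₁ _ ((hW x₂).1 hx₂)]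
  · have hx' : ∀ x₂ ∈ W₂, e₂ x₂ ≠ x₂' := fun x₂ h₂ h => hx ⟨x₂, h₂, h⟩
    rw [restrictOp_apply_of_not_mem _ hx', restrictOp_apply_of_not_mem _ (hcompl x₂' hx')]

omit [Fintype X₁] [Fintype X₂] [Fintype X₁'] [Fintype X₂'] in
/-- ★★ **THE η-DEFECT OF TWO TRANSPLANTS IS THE TWO-LATTICE TRANSPLANT OF THE SMALL DEFECT**: `𝔇_{pull p, pull p}(ε₂X₂′ρ₂, ε₁X₁′ρ₁) = ε₂ ∘ 𝔇_{pull p′, pull p′}(X₂′, X₁′) ∘ ρ₁` under the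
compatibilities of `restrictOp_comp_pull_of_compl`. [cite: Balaban1984PropagatorsII, p.238 (T_□), (2.133) p.247 (shape); King1986, p.664] -/
theorem idef_transplant_eq_extend_comp_restrict (hinj₁ : Set.InjOn e₁ ↑W₁) (hinj₂ : Set.InjOn e₂ ↑W₂) (hW : ∀ x₂, x₂ ∈ W₂ ↔ p x₂ ∈ W₁)
    (hcompat : ∀ x₂ ∈ W₂, e₁ (p x₂) = p' (e₂ x₂)) (hcompl : ∀ x₂' : X₂', (∀ x₂ ∈ W₂, e₂ x₂ ≠ x₂') → ∀ x₁ ∈ W₁, e₁ x₁ ≠ p' x₂')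
    (X₁' : Module.End ℝ (X₁' → ℝ)) (X₂' : Module.End ℝ (X₂' → ℝ)) :
    idef (pull p) (pull p) (transplant W₂ e₂ X₂') (transplant W₁ e₁ X₁') = extendOp W₂ e₂ ∘ₗ idef (pull p') (pull p') X₂' X₁' ∘ₗ restrictOp W₁ e₁ := by
  have h1 : pull p ∘ₗ extendOp W₁ e₁ = extendOp W₂ e₂ ∘ₗ pull p' := by
    refine LinearMap.ext fun g => funext fun x₂ => ?_
    rw [LinearMap.comp_apply, LinearMap.comp_apply, pull_apply, extendOp_apply, extendOp_apply, pull_apply]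
    by_cases hx : x₂ ∈ W₂
    · rw [if_pos ((hW x₂).1 hx), if_pos hx, hcompat x₂ hx]
    · rw [if_neg (fun h' => hx ((hW x₂).2 h')), if_neg hx]
  have h2 := restrictOp_comp_pull_of_compl W₁ e₁ W₂ e₂ p p' hinj₁ hinj₂ hW hcompat hcompl
  rw [idef, idef, transplant, transplant, LinearMap.comp_assoc, LinearMap.comp_assoc, h2, ← LinearMap.comp_assoc (restrictOp W₁ e₁), ← LinearMap.comp_assoc (restrictOp W₁ e₁),
    ← LinearMap.comp_assoc (X₁' ∘ₗ restrictOp W₁ e₁), h1]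
  simp only [LinearMap.comp_sub, LinearMap.sub_comp, LinearMap.comp_assoc]

omit [DecidableEq X₁] [DecidableEq X₂'] in
/-- ★★ **THE TWO-LATTICE TRANSFER LEMMA**: a block majorant of `T′ : (X₁′ → ℝ) → (X₂′ → ℝ)` (small geometry `g′`, blocks `blk₁′, blk₂′`) passes to `ε₂ ∘ T′ ∘ ρ₁` on the big lattices
(geometry `g`, blocks `blk₁, blk₂`) along windows `W₁, W₂` with `e₁` injective on `W₁`, ONE map of blocks `σ` with `blkᵢ′ ∘ eᵢ = σ ∘ blkᵢ` on `Wᵢ`, the windows' blocks lying in `B`;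
kernel read at `(σy, σy′)` with the indicators of `B`. [cite: Balaban1984PropagatorsII, (2.133) p.247 (shape), p.238 (T_□)] -/
theorem hasMaj_extend_comp_restrict_of_blockMap {g g' : B6.Geometry} (blk₁ : X₁ → g.Site) (blk₂ : X₂ → g.Site) (blk₁' : X₁' → g'.Site) (blk₂' : X₂' → g'.Site)
    (σ : g.Site → g'.Site) (B : Set g.Site) (hblk₁ : ∀ x ∈ W₁, blk₁' (e₁ x) = σ (blk₁ x)) (hblk₂ : ∀ x ∈ W₂, blk₂' (e₂ x) = σ (blk₂ x))
    (hWB₁ : ∀ x ∈ W₁, blk₁ x ∈ B) (hWB₂ : ∀ x ∈ W₂, blk₂ x ∈ B) (hinj₁ : Set.InjOn e₁ ↑W₁) {T' : (X₁' → ℝ) →ₗ[ℝ] (X₂' → ℝ)} {K' : g'.Site → g'.Site → ℝ}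
    (hK' : ∀ a b, 0 ≤ K' a b) (hT : HasMaj (BlockNorm.ofBlocks g' blk₁') (BlockNorm.ofBlocks g' blk₂') T' K') :
    HasMaj (BlockNorm.ofBlocks g blk₁) (BlockNorm.ofBlocks g blk₂) (extendOp W₂ e₂ ∘ₗ T' ∘ₗ restrictOp W₁ e₁) (fun y y' => ind B y * ind B y' * K' (σ y) (σ y')) := by
  classical
  intro y' μ hμ y
  dsimp only
  have hμ' : ∀ x, blk₁ x ≠ y' → μ x = 0 := hμ
  have hloc0 : 0 ≤ (BlockNorm.ofBlocks g blk₁).loc y' μ := (BlockNorm.ofBlocks g blk₁).loc_nonneg y' μ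
  by_cases hy' : y' ∈ B
  swap
  · have hρ : restrictOp W₁ e₁ μ = 0 := by
      funext x'
      rw [restrictOp_apply, Pi.zero_apply]
      refine Finset.sum_eq_zero fun x hx => ?_
      rw [Finset.mem_filter] at hx
      exact hμ' x fun hb => hy' (hb ▸ hWB₁ x hx.1)
    have h0 : (extendOp W₂ e₂ ∘ₗ T' ∘ₗ restrictOp W₁ e₁) μ = 0 := by rw [LinearMap.comp_apply, LinearMap.comp_apply, hρ, map_zero, map_zero]
    rw [h0, (BlockNorm.ofBlocks g blk₂).loc_zero]
    exact mul_nonneg (mul_nonneg (mul_nonneg (ind_nonneg _ _) (ind_nonneg _ _)) (hK' _ _)) hloc0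
  have hlocμ : (BlockNorm.ofBlocks g' blk₁').IsLoc (σ y') (restrictOp W₁ e₁ μ) := by
    intro x' hx'
    rw [restrictOp_apply]
    refine Finset.sum_eq_zero fun x hx => ?_
    rw [Finset.mem_filter] at hx
    by_contra hne
    have hb : blk₁ x = y' := by by_contra hb; exact hne (hμ' x hb)
    exact hx' (by rw [← hx.2, hblk₁ x hx.1, hb])
  have hle : (BlockNorm.ofBlocks g' blk₁').loc (σ y') (restrictOp W₁ e₁ μ) ≤ (BlockNorm.ofBlocks g blk₁).loc y' μ := by
    refine loc_ofBlocks_le blk₁' _ hloc0 fun x' _ => ?_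
    by_cases hex : ∃ x ∈ W₁, e₁ x = x' ∧ μ x ≠ 0
    · obtain ⟨x, hxW, hxe, hxμ⟩ := hex
      have hb : blk₁ x = y' := by by_contra hb; exact hxμ (hμ' x hb)
      rw [← hxe, restrictOp_apply_of_injOn hinj₁ μ hxW]
      exact abs_le_loc_ofBlocks blk₁ μ hb
    · have h0 : restrictOp W₁ e₁ μ x' = 0 := by
        rw [restrictOp_apply]
        refine Finset.sum_eq_zero fun x hx => ?_
        rw [Finset.mem_filter] at hx
        by_contra hne
        exact hex ⟨x, hx.1, hx.2, hne⟩
      rw [h0, abs_zero]; exact (BlockNorm.ofBlocks g blk₁).loc_nonneg y' μ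
  have h1 := hT (σ y') (restrictOp W₁ e₁ μ) hlocμ (σ y)
  have hout : (BlockNorm.ofBlocks g blk₂).loc y ((extendOp W₂ e₂ ∘ₗ T' ∘ₗ restrictOp W₁ e₁) μ) ≤ ind B y * (BlockNorm.ofBlocks g' blk₂').loc (σ y) (T' (restrictOp W₁ e₁ μ)) := by
    refine loc_ofBlocks_le blk₂ _ (mul_nonneg (ind_nonneg _ _) ((BlockNorm.ofBlocks g' blk₂').loc_nonneg _ _)) fun x hx => ?_
    rw [LinearMap.comp_apply, LinearMap.comp_apply, extendOp_apply]
    by_cases hxW : x ∈ W₂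
    · rw [if_pos hxW, show ind B y = 1 from by unfold ind; rw [if_pos (hx ▸ hWB₂ x hxW)], one_mul]
      exact abs_le_loc_ofBlocks blk₂' _ (by rw [hblk₂ x hxW, hx])
    · rw [if_neg hxW, abs_zero]; exact mul_nonneg (ind_nonneg _ _) ((BlockNorm.ofBlocks g' blk₂').loc_nonneg _ _)
  rw [show ind B y' = 1 from by unfold ind; rw [if_pos hy'], mul_one]
  calc (BlockNorm.ofBlocks g blk₂).loc y ((extendOp W₂ e₂ ∘ₗ T' ∘ₗ restrictOp W₁ e₁) μ)
      ≤ ind B y * (BlockNorm.ofBlocks g' blk₂').loc (σ y) (T' (restrictOp W₁ e₁ μ)) := hout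
    _ ≤ ind B y * (K' (σ y) (σ y') * (BlockNorm.ofBlocks g blk₁).loc y' μ) :=
        mul_le_mul_of_nonneg_left (h1.trans (mul_le_mul_of_nonneg_left hle (hK' _ _))) (ind_nonneg _ _)
    _ = ind B y * K' (σ y) (σ y') * (BlockNorm.ofBlocks g blk₁).loc y' μ := by ring

omit [Fintype X₂] [Fintype X₂'] [DecidableEq X₂'] in
/-- an output cut equal to `1` on the image of the window is invisible after the extension by zero. [folklore] -/
theorem extendOp_comp_mulOp_of_eq_one {χ : X₂' → ℝ} (hχ : ∀ x ∈ W₂, χ (e₂ x) = 1) : extendOp W₂ e₂ ∘ₗ mulOp χ = extendOp W₂ e₂ := by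
  refine LinearMap.ext fun g => funext fun x => ?_
  rw [LinearMap.comp_apply, extendOp_apply, extendOp_apply]
  by_cases hx : x ∈ W₂
  · rw [if_pos hx, if_pos hx, mulOp_apply, hχ x hx, one_mul]
  · rw [if_neg hx, if_neg hx]

omit [Fintype X₁'] [Fintype X₂'] [DecidableEq X₁'] [DecidableEq X₂'] in
/-- moving compatible cuts through the small defect: `𝔇(M_{χ₂}X₂′, M_{χ₁}X₁′) = M_{χ₂} ∘ 𝔇(X₂′, X₁′)` when `χ₁ ∘ p′ = χ₂`. [folklore] -/
theorem idef_mulOp_mulOp_of_comp {χ₁ : X₁' → ℝ} {χ₂ : X₂' → ℝ} (hχ : ∀ x₂', χ₁ (p' x₂') = χ₂ x₂') (X₁' : Module.End ℝ (X₁' → ℝ)) (X₂' : Module.End ℝ (X₂' → ℝ)) :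
    idef (pull p') (pull p') (mulOp χ₂ ∘ₗ X₂') (mulOp χ₁ ∘ₗ X₁') = mulOp χ₂ ∘ₗ idef (pull p') (pull p') X₂' X₁' := by
  have h : pull p' ∘ₗ mulOp χ₁ = mulOp χ₂ ∘ₗ pull p' := by
    refine LinearMap.ext fun g => funext fun x => ?_
    rw [LinearMap.comp_apply, LinearMap.comp_apply, pull_apply, mulOp_apply, mulOp_apply, pull_apply, hχ]
  rw [idef, idef, LinearMap.comp_sub, LinearMap.comp_assoc, ← LinearMap.comp_assoc X₁', h, LinearMap.comp_assoc]

end TwoLattice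

/-! ## §13 THE TWO-GRID η-DEFECT OF THE LIFTED CUBE PROPAGATORS ON THE TORUS FAMILY OF RECORD (`hDGc`), cube side `L^s` FIXED, volume FREE -/

section DefectFamily

open Literature.MathematicalPhysics.QuantumFieldTheory.Balaban1983to89.B6Prop26Gluing (mulOp mulOp_apply ind ind_nonneg ind_le_one)
open Literature.MathematicalPhysics.QuantumFieldTheory.Balaban1983to89.B6Prop26ReachTransplant (restrictOp extendOp transplant)
open Literature.MathematicalPhysics.QuantumFieldTheory.King1986.Torus (blockOf tdistT)
open Literature.MathematicalPhysics.QuantumFieldTheory.Balaban1983to89.T4EtaRateDefect (idef)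
open Literature.MathematicalPhysics.QuantumFieldTheory.Balaban1983to89.T4EtaRateCoeffDefect (pull pull_apply)
open Literature.MathematicalPhysics.QuantumFieldTheory.Balaban1983to89.B11SectG (BlockNorm HasMaj)
open Literature.MathematicalPhysics.QuantumFieldTheory.Balaban1983to89.B6UnitTorusCarrier (unitTorusGeo)
open Literature.MathematicalPhysics.QuantumFieldTheory.Balaban1983to89.B5SiteBridgeP12 (MP)
open Summit.QuantumFields.YangMills.BalabanUVNodes.N15.VectorPiece (kingPr kingPrV kingPr_val kingPrV_eq blkFine blkFine_comp_kingPrV)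

variable {L : ℕ} [NeZero L]

/-- ★★ **THE TWO-GRID FAMILY TRANSFER THEOREM**: for small-torus operators `X₁′` (spacing `L^k`) and `X₂′` (spacing `L^r·L^k`) whose cube-cut two-grid defect through King's pairing carries a
letter `1_{□′}1_{□′}·m·e^{−δd′}`, the cut lifts `transplant W₂ π X₂′`, `transplant W₁ π X₁′` on the torus of record have the two-grid defect letter `1_□1_□·m·e^{−δ|y−y′|_T}` (SAME `m, δ`),
for every `s ≤ m_T` and corner `c`. [cite: Balaban1984PropagatorsII, (2.133)–(2.136) p.247 (shapes), p.238 (T_□); King1986, p.664] -/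
theorem hasMaj_idef_transplant_cube_family (hL : Odd L ∧ 1 < L) {s mT k r : ℕ} (hs : s ≤ mT) (c : Tor (MP (paramsOf d L mT k hL)))
    (X₁' : Module.End ℝ (Tor (fine (L ^ k) (MP (paramsOf d L s k hL))) × Fin (d + 1) → ℝ))
    (X₂' : Module.End ℝ (Tor (fine (L ^ r * L ^ k) (MP (paramsOf d L s k hL))) × Fin (d + 1) → ℝ)) {m δ : ℝ} (hm : 0 ≤ m)
    (hX : HasMaj (BlockNorm.ofBlocks (unitTorusGeo L k (MP (paramsOf d L s k hL))) (blkFine L k (MP (paramsOf d L s k hL))))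
      (BlockNorm.ofBlocks (unitTorusGeo L k (MP (paramsOf d L s k hL)))
        (fun i : Tor (fine (L ^ r * L ^ k) (MP (paramsOf d L s k hL))) × Fin (d + 1) => blockOf (L ^ r * L ^ k) (MP (paramsOf d L s k hL)) i.1))
      (idef (pull (kingPrV L k r (MP (paramsOf d L s k hL)))) (pull (kingPrV L k r (MP (paramsOf d L s k hL))))
        (mulOp (chiCube (MP (paramsOf d L s k hL)) (L ^ r * L ^ k) (torRed (MP_dvd_MP hL hs k) c) (L ^ s)) ∘ₗ X₂')
        (mulOp (chiCube (MP (paramsOf d L s k hL)) (L ^ k) (torRed (MP_dvd_MP hL hs k) c) (L ^ s)) ∘ₗ X₁'))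
      (fun y y' => ind ((cubeBlocks (MP (paramsOf d L s k hL)) (torRed (MP_dvd_MP hL hs k) c) (L ^ s) : Finset _) : Set _) y *
        ind ((cubeBlocks (MP (paramsOf d L s k hL)) (torRed (MP_dvd_MP hL hs k) c) (L ^ s) : Finset _) : Set _) y' *
        (m * Real.exp (-(δ * tdistT (MP (paramsOf d L s k hL)) y y'))))) :
    HasMaj (BlockNorm.ofBlocks (unitTorusGeo L k (MP (paramsOf d L mT k hL))) (blkFine L k (MP (paramsOf d L mT k hL))))
      (BlockNorm.ofBlocks (unitTorusGeo L k (MP (paramsOf d L mT k hL)))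
        (fun i : Tor (fine (L ^ r * L ^ k) (MP (paramsOf d L mT k hL))) × Fin (d + 1) => blockOf (L ^ r * L ^ k) (MP (paramsOf d L mT k hL)) i.1))
      (idef (pull (kingPrV L k r (MP (paramsOf d L mT k hL)))) (pull (kingPrV L k r (MP (paramsOf d L mT k hL))))
        (transplant (cubeW (L ^ r * L ^ k) c (L ^ s)) (redBond (L ^ r * L ^ k) (MP_dvd_MP hL hs k)) X₂')
        (transplant (cubeW (L ^ k) c (L ^ s)) (redBond (L ^ k) (MP_dvd_MP hL hs k)) X₁'))
      (fun y y' => ind ((cubeBlocks (MP (paramsOf d L mT k hL)) c (L ^ s) : Finset _) : Set _) y *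
        ind ((cubeBlocks (MP (paramsOf d L mT k hL)) c (L ^ s) : Finset _) : Set _) y' *
        (m * Real.exp (-(δ * tdistT (MP (paramsOf d L mT k hL)) y y')))) := by
  have hM := MP_dvd_MP (d := d) hL hs k
  have hLpos : 0 < L := by have := hL.2; omega
  have hS : ∀ ν : Fin (d + 1), L ^ s ≤ MP (paramsOf d L s k hL) ν := fun ν => by show L ^ s ≤ 2 * L ^ s; omega
  have hS2' : ∀ ν : Fin (d + 1), 2 * L ^ s ≤ MP (paramsOf d L s k hL) ν := fun ν => le_rfl
  have hS2 : ∀ ν : Fin (d + 1), 2 * L ^ s ≤ MP (paramsOf d L mT k hL) ν := fun ν => by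
    show 2 * L ^ s ≤ 2 * L ^ mT; exact Nat.mul_le_mul_left 2 (Nat.pow_le_pow_right hLpos hs)
  -- (1) the defect of the two transplants is the two-lattice transplant of the small defect
  have hW : ∀ x₂, x₂ ∈ cubeW (L ^ r * L ^ k) c (L ^ s) ↔ kingPrV L k r (MP (paramsOf d L mT k hL)) x₂ ∈ cubeW (L ^ k) c (L ^ s) :=
    fun x₂ => (kingPrV_mem_cubeW_iff x₂).symm
  have hcompat : ∀ x₂ ∈ cubeW (L ^ r * L ^ k) c (L ^ s), redBond (L ^ k) hM (kingPrV L k r (MP (paramsOf d L mT k hL)) x₂) =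
      kingPrV L k r (MP (paramsOf d L s k hL)) (redBond (L ^ r * L ^ k) hM x₂) := fun x₂ _ => (kingPrV_redBond hM x₂).symm
  have e1 := idef_transplant_eq_extend_comp_restrict (cubeW (L ^ k) c (L ^ s)) (redBond (L ^ k) hM) (cubeW (L ^ r * L ^ k) c (L ^ s)) (redBond (L ^ r * L ^ k) hM)
    (kingPrV L k r (MP (paramsOf d L mT k hL))) (kingPrV L k r (MP (paramsOf d L s k hL))) (redBond_injOn_cubeW hS) (redBond_injOn_cubeW hS) hW hcompat
    (fun x₂' hx => kingPrV_not_mem_image hM x₂' hx) X₁' X₂'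
  -- (2) the small-torus cuts: `χ₁′ ∘ p′ = χ₂′`, and `ε₂ ∘ M_{χ₂′} = ε₂`
  have hχ : ∀ x₂', chiCube (MP (paramsOf d L s k hL)) (L ^ k) (torRed hM c) (L ^ s) (kingPrV L k r (MP (paramsOf d L s k hL)) x₂') =
      chiCube (MP (paramsOf d L s k hL)) (L ^ r * L ^ k) (torRed hM c) (L ^ s) x₂' := fun x₂' => chiCube_kingPrV L k r (torRed hM c) (L ^ s) x₂'
  have e2 := idef_mulOp_mulOp_of_comp (kingPrV L k r (MP (paramsOf d L s k hL))) hχ X₁' X₂'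
  have e3 := extendOp_comp_mulOp_of_eq_one (cubeW (L ^ r * L ^ k) c (L ^ s)) (redBond (L ^ r * L ^ k) hM)
    (χ := chiCube (MP (paramsOf d L s k hL)) (L ^ r * L ^ k) (torRed hM c) (L ^ s)) (fun b hb => chiCube_redBond_of_mem hS hb)
  have e4 : idef (pull (kingPrV L k r (MP (paramsOf d L mT k hL)))) (pull (kingPrV L k r (MP (paramsOf d L mT k hL))))
        (transplant (cubeW (L ^ r * L ^ k) c (L ^ s)) (redBond (L ^ r * L ^ k) hM) X₂') (transplant (cubeW (L ^ k) c (L ^ s)) (redBond (L ^ k) hM) X₁') =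
      extendOp (cubeW (L ^ r * L ^ k) c (L ^ s)) (redBond (L ^ r * L ^ k) hM) ∘ₗ
        idef (pull (kingPrV L k r (MP (paramsOf d L s k hL)))) (pull (kingPrV L k r (MP (paramsOf d L s k hL))))
          (mulOp (chiCube (MP (paramsOf d L s k hL)) (L ^ r * L ^ k) (torRed hM c) (L ^ s)) ∘ₗ X₂')
          (mulOp (chiCube (MP (paramsOf d L s k hL)) (L ^ k) (torRed hM c) (L ^ s)) ∘ₗ X₁') ∘ₗ
        restrictOp (cubeW (L ^ k) c (L ^ s)) (redBond (L ^ k) hM) := by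
    rw [e1, e2, LinearMap.comp_assoc, ← LinearMap.comp_assoc _ (mulOp _) (extendOp _ _), e3]
  -- (3) the two-lattice transfer
  have key := hasMaj_extend_comp_restrict_of_blockMap (cubeW (L ^ k) c (L ^ s)) (redBond (L ^ k) hM) (cubeW (L ^ r * L ^ k) c (L ^ s)) (redBond (L ^ r * L ^ k) hM)
    (g := unitTorusGeo L k (MP (paramsOf d L mT k hL))) (g' := unitTorusGeo L k (MP (paramsOf d L s k hL)))
    (blkFine L k (MP (paramsOf d L mT k hL))) (fun i : Tor (fine (L ^ r * L ^ k) (MP (paramsOf d L mT k hL))) × Fin (d + 1) => blockOf (L ^ r * L ^ k) (MP (paramsOf d L mT k hL)) i.1)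
    (blkFine L k (MP (paramsOf d L s k hL))) (fun i : Tor (fine (L ^ r * L ^ k) (MP (paramsOf d L s k hL))) × Fin (d + 1) => blockOf (L ^ r * L ^ k) (MP (paramsOf d L s k hL)) i.1)
    (torRed hM) ((cubeBlocks (MP (paramsOf d L mT k hL)) c (L ^ s) : Finset _) : Set _)
    (fun b _ => kingBlockOf_torRed (hM := hM) b.1) (fun b _ => kingBlockOf_torRed (hM := hM) b.1)
    (fun b hb => Finset.mem_coe.mpr ((mem_cubeW b).mp hb)) (fun b hb => Finset.mem_coe.mpr ((mem_cubeW b).mp hb)) (redBond_injOn_cubeW hS) (fun _ _ => ?_) hX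
  · refine (key.mono fun y y' => le_of_eq ?_).congr fun μ => (LinearMap.congr_fun e4 μ).symm
    show ind (g := unitTorusGeo L k (MP (paramsOf d L mT k hL))) ((cubeBlocks (MP (paramsOf d L mT k hL)) c (L ^ s) : Finset _) : Set _) y *
        ind (g := unitTorusGeo L k (MP (paramsOf d L mT k hL))) ((cubeBlocks (MP (paramsOf d L mT k hL)) c (L ^ s) : Finset _) : Set _) y' *
        (ind (g := unitTorusGeo L k (MP (paramsOf d L s k hL))) ((cubeBlocks (MP (paramsOf d L s k hL)) (torRed hM c) (L ^ s) : Finset _) : Set _) (torRed hM y) *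
          ind (g := unitTorusGeo L k (MP (paramsOf d L s k hL))) ((cubeBlocks (MP (paramsOf d L s k hL)) (torRed hM c) (L ^ s) : Finset _) : Set _) (torRed hM y') *
          (m * Real.exp (-(δ * tdistT (MP (paramsOf d L s k hL)) (torRed hM y) (torRed hM y'))))) =
      ind (g := unitTorusGeo L k (MP (paramsOf d L mT k hL))) ((cubeBlocks (MP (paramsOf d L mT k hL)) c (L ^ s) : Finset _) : Set _) y *
        ind (g := unitTorusGeo L k (MP (paramsOf d L mT k hL))) ((cubeBlocks (MP (paramsOf d L mT k hL)) c (L ^ s) : Finset _) : Set _) y' *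
        (m * Real.exp (-(δ * tdistT (MP (paramsOf d L mT k hL)) y y')))
    by_cases hy : y ∈ ((cubeBlocks (MP (paramsOf d L mT k hL)) c (L ^ s) : Finset _) : Set _)
    · by_cases hy' : y' ∈ ((cubeBlocks (MP (paramsOf d L mT k hL)) c (L ^ s) : Finset _) : Set _)
      · have iy : ind (g := unitTorusGeo L k (MP (paramsOf d L s k hL))) ((cubeBlocks (MP (paramsOf d L s k hL)) (torRed hM c) (L ^ s) : Finset _) : Set _)
            (torRed hM y) = 1 := by
          unfold ind; rw [if_pos (Finset.mem_coe.mpr (torRed_mem_cubeBlocks hS (Finset.mem_coe.mp hy)))]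
        have iy' : ind (g := unitTorusGeo L k (MP (paramsOf d L s k hL))) ((cubeBlocks (MP (paramsOf d L s k hL)) (torRed hM c) (L ^ s) : Finset _) : Set _)
            (torRed hM y') = 1 := by
          unfold ind; rw [if_pos (Finset.mem_coe.mpr (torRed_mem_cubeBlocks hS (Finset.mem_coe.mp hy')))]
        have hd : tdistT (MP (paramsOf d L s k hL)) (torRed hM y) (torRed hM y') = tdistT (MP (paramsOf d L mT k hL)) y y' :=
          tdistT_torRed_eq hS2 hS2' (Finset.mem_coe.mp hy) (Finset.mem_coe.mp hy')
        rw [iy, iy', one_mul, one_mul, hd]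
      · have i0 : ind (g := unitTorusGeo L k (MP (paramsOf d L mT k hL))) ((cubeBlocks (MP (paramsOf d L mT k hL)) c (L ^ s) : Finset _) : Set _) y' = 0 := by
          unfold ind; rw [if_neg hy']
        rw [i0]; ring
    · have i0 : ind (g := unitTorusGeo L k (MP (paramsOf d L mT k hL))) ((cubeBlocks (MP (paramsOf d L mT k hL)) c (L ^ s) : Finset _) : Set _) y = 0 := by
        unfold ind; rw [if_neg hy]
      rw [i0]; ring
  · exact mul_nonneg (mul_nonneg (ind_nonneg _ _) (ind_nonneg _ _)) (mul_nonneg hm (Real.exp_nonneg _))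

/-- ★★★ **THE TWO-GRID η-DEFECT `hDGc` OF THE LIFTED NEUMANN CUBE PROPAGATORS ON THE TORUS FAMILY OF RECORD, UNIFORM IN THE VOLUME**: for odd `L ≥ 3`, `a > 0`, `0 < γ < 1` there are `δ, m > 0`
(N-IIc's, for the doubled tori — i.e. King's two-grid rate `(L^k)^{−γ∕2}` of part 52 through the method of images) such that for EVERY cube exponent `s`, volume exponent `m_T ≥ s`, coarse
level `k ≥ 1`, refinement `r` and corner `c`: `𝔇_{pull pr, pull pr}(χ_□G₂^{↑}(□ + c), χ_□G₁^{↑}(□ + c)) ≤ 1_□(y)1_□(y′)·m·(L^k)^{−γ∕2}·e^{−δ|y−y′|_T}` (spacings `L^k` and `L^r·L^k` of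
`Tor (fine · M)`, `M_ν = 2L^{m_T}`, cube side `L^s`). [cite: Balaban1984PropagatorsII, (2.133)–(2.136) p.247 (shapes), (2.37) p.229, p.238 (T_□); Balaban1984PropagatorsI, (1.121)–(1.123) p.37; King1986, Prop. 3.8 (3.71) p.664] -/
theorem hasMaj_idef_chiCube_liftCubeG (hLodd : Odd L) (hL2 : 2 ≤ L) {a : ℝ} (ha : 0 < a) {γ : ℝ} (hγ0 : 0 < γ) (hγ1 : γ < 1) :
    ∃ δ m : ℝ, 0 < δ ∧ 0 < m ∧ ∀ (s mT k r : ℕ) (hk : 1 ≤ k) (hL : Odd L ∧ 1 < L) (hs : s ≤ mT) (c : Tor (MP (paramsOf d L mT k hL))),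
      HasMaj (BlockNorm.ofBlocks (unitTorusGeo L k (MP (paramsOf d L mT k hL))) (blkFine L k (MP (paramsOf d L mT k hL))))
        (BlockNorm.ofBlocks (unitTorusGeo L k (MP (paramsOf d L mT k hL)))
          (fun i : Tor (fine (L ^ r * L ^ k) (MP (paramsOf d L mT k hL))) × Fin (d + 1) => blockOf (L ^ r * L ^ k) (MP (paramsOf d L mT k hL)) i.1))
        (idef (pull (kingPrV L k r (MP (paramsOf d L mT k hL)))) (pull (kingPrV L k r (MP (paramsOf d L mT k hL))))
          (mulOp (chiCube (MP (paramsOf d L mT k hL)) (L ^ r * L ^ k) c (L ^ s)) ∘ₗ liftCubeG (L ^ r * L ^ k) (MP_dvd_MP hL hs k) c (L ^ s) a)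
          (mulOp (chiCube (MP (paramsOf d L mT k hL)) (L ^ k) c (L ^ s)) ∘ₗ liftCubeG (L ^ k) (MP_dvd_MP hL hs k) c (L ^ s) a))
        (fun y y' => ind ((cubeBlocks (MP (paramsOf d L mT k hL)) c (L ^ s) : Finset _) : Set _) y *
          ind ((cubeBlocks (MP (paramsOf d L mT k hL)) c (L ^ s) : Finset _) : Set _) y' *
          (m * ((L ^ k : ℕ) : ℝ) ^ (-(γ / 2)) * Real.exp (-(δ * tdistT (MP (paramsOf d L mT k hL)) y y')))) := by
  obtain ⟨δ, m, hδ, hm, H⟩ := hasMaj_idef_chiCube_neumannCubeG (d := d) hLodd hL2 ha hγ0 hγ1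
  refine ⟨δ, m, hδ, hm, fun s mT k r hk hL hs c => ?_⟩
  have hρ : 0 ≤ m * ((L ^ k : ℕ) : ℝ) ^ (-(γ / 2)) := mul_nonneg hm.le (Real.rpow_nonneg (Nat.cast_nonneg _) _)
  have h := hasMaj_idef_transplant_cube_family (d := d) hL (r := r) hs c _ _ hρ (H s k r hk hL (torRed (MP_dvd_MP hL hs k) c))
  have e₂ := mulOp_chiCube_comp_liftCubeG (L ^ r * L ^ k) (MP_dvd_MP hL hs k) c (L ^ s) a
  have e₁ := mulOp_chiCube_comp_liftCubeG (L ^ k) (MP_dvd_MP hL hs k) c (L ^ s) a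
  have E := congrArg₂ (idef (pull (kingPrV L k r (MP (paramsOf d L mT k hL)))) (pull (kingPrV L k r (MP (paramsOf d L mT k hL))))) e₂ e₁
  refine (h.mono fun y y' => le_of_eq ?_).congr fun μ => (LinearMap.congr_fun E μ).symm
  ring

/-- the cut lifted gradient row operator IS a transplant: `M_{χ_□} ∘ ∇_ν ∘ G^{↑}(□) = transplant W π (∇′_ν ∘ G(□′))` (the forward difference descends). [folklore] -/
theorem mulOp_chiCube_comp_sD_comp_liftCubeG {M M' : Fin (d + 1) → ℕ} [∀ μ, NeZero (M μ)] [∀ μ, NeZero (M' μ)] (n : ℕ) [NeZero n] (hM : ∀ μ, M' μ ∣ M μ) (c : Tor M) (S : ℕ)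
    (a : ℝ) (ν : Fin (d + 1)) (cc : ℝ) :
    mulOp (chiCube M n c S) ∘ₗ symbOp M n (sD M n ν cc) ∘ₗ liftCubeG n hM c S a =
      transplant (cubeW n c S) (redBond n hM) (symbOp M' n (sD M' n ν cc) ∘ₗ neumannCubeG M' n (torRed hM c) S a) := by
  rw [liftCubeG_eq_liftOp, comp_liftOp_of_comm n hM c S (symbOp_sD_comp_pullVR n hM ν cc), mulOp_chiCube_comp_liftOp]

/-- ★★★ **THE ENTRY-1 TWO-GRID η-DEFECT OF THE LIFTED CUBES ON THE TORUS FAMILY OF RECORD** (`𝔇(∇′G₂^{↑}, ∇G₁^{↑})` cut to the cube): N-IIe's letter `1_□1_□·m·(L^k)^{−1∕16}·e^{−δd}` (for `4 ≤ L^k`),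
for EVERY `s ≤ m_T`, `k`, `r`, corner `c`, direction `ν` — uniform in the volume. [cite: Balaban1984PropagatorsII, (2.133)–(2.136) p.247 (shapes); Balaban1984PropagatorsI, (1.111) p.36, (1.121)–(1.123) p.37] -/
theorem hasMaj_idef_chiCube_grad_liftCubeG (hLodd : Odd L) (hL2 : 2 ≤ L) {a : ℝ} (ha : 0 < a) :
    ∃ δ m : ℝ, 0 < δ ∧ 0 < m ∧ ∀ (s mT k r : ℕ) (hk : 1 ≤ k) (hn4 : 4 ≤ L ^ k) (hL : Odd L ∧ 1 < L) (hs : s ≤ mT) (c : Tor (MP (paramsOf d L mT k hL))) (ν : Fin (d + 1)),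
      HasMaj (BlockNorm.ofBlocks (unitTorusGeo L k (MP (paramsOf d L mT k hL))) (blkFine L k (MP (paramsOf d L mT k hL))))
        (BlockNorm.ofBlocks (unitTorusGeo L k (MP (paramsOf d L mT k hL)))
          (fun i : Tor (fine (L ^ r * L ^ k) (MP (paramsOf d L mT k hL))) × Fin (d + 1) => blockOf (L ^ r * L ^ k) (MP (paramsOf d L mT k hL)) i.1))
        (idef (pull (kingPrV L k r (MP (paramsOf d L mT k hL)))) (pull (kingPrV L k r (MP (paramsOf d L mT k hL))))
          (mulOp (chiCube (MP (paramsOf d L mT k hL)) (L ^ r * L ^ k) c (L ^ s)) ∘ₗ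
            symbOp (MP (paramsOf d L mT k hL)) (L ^ r * L ^ k) (sD (MP (paramsOf d L mT k hL)) (L ^ r * L ^ k) ν ((L ^ r * L ^ k : ℕ) : ℝ)) ∘ₗ
              liftCubeG (L ^ r * L ^ k) (MP_dvd_MP hL hs k) c (L ^ s) a)
          (mulOp (chiCube (MP (paramsOf d L mT k hL)) (L ^ k) c (L ^ s)) ∘ₗ
            symbOp (MP (paramsOf d L mT k hL)) (L ^ k) (sD (MP (paramsOf d L mT k hL)) (L ^ k) ν ((L ^ k : ℕ) : ℝ)) ∘ₗ
              liftCubeG (L ^ k) (MP_dvd_MP hL hs k) c (L ^ s) a))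
        (fun y y' => ind ((cubeBlocks (MP (paramsOf d L mT k hL)) c (L ^ s) : Finset _) : Set _) y *
          ind ((cubeBlocks (MP (paramsOf d L mT k hL)) c (L ^ s) : Finset _) : Set _) y' *
          (m * ((L ^ k : ℕ) : ℝ) ^ (-(1 / 16 : ℝ)) * Real.exp (-(δ * tdistT (MP (paramsOf d L mT k hL)) y y')))) := by
  obtain ⟨δ, m, hδ, hm, H⟩ := hasMaj_idef_chiCube_grad_neumannCubeG (d := d) hLodd hL2 ha
  refine ⟨δ, m, hδ, hm, fun s mT k r hk hn4 hL hs c ν => ?_⟩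
  have hρ : 0 ≤ m * ((L ^ k : ℕ) : ℝ) ^ (-(1 / 16 : ℝ)) := mul_nonneg hm.le (Real.rpow_nonneg (Nat.cast_nonneg _) _)
  have h := hasMaj_idef_transplant_cube_family (d := d) hL (r := r) hs c _ _ hρ (H s k r hk hn4 hL (torRed (MP_dvd_MP hL hs k) c) ν)
  have e₂ := mulOp_chiCube_comp_sD_comp_liftCubeG (L ^ r * L ^ k) (MP_dvd_MP hL hs k) c (L ^ s) a ν ((L ^ r * L ^ k : ℕ) : ℝ)
  have e₁ := mulOp_chiCube_comp_sD_comp_liftCubeG (L ^ k) (MP_dvd_MP hL hs k) c (L ^ s) a ν ((L ^ k : ℕ) : ℝ)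
  have E := congrArg₂ (idef (pull (kingPrV L k r (MP (paramsOf d L mT k hL)))) (pull (kingPrV L k r (MP (paramsOf d L mT k hL))))) e₂ e₁
  refine (h.mono fun y y' => le_of_eq ?_).congr fun μ => (LinearMap.congr_fun E μ).symm
  ring

end DefectFamily

end Summit.QuantumFields.YangMills.BalabanUVNodes.N15.TwoGrid

end
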